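import Summits.QuantumFields.YangMills.Theorems.UnitScaleTiltFluctuationComparisonRegPrPrintChiSlack
import Summits.QuantumFields.YangMills.Theorems.UnitScaleTiltFluctuationComparisonRegPrPrintChiEdgeAt
import HarnessLib

/-!
# `UnitScaleTiltFluctuationComparisonRegPrPrintChiFourPrimeAt` — STUB 4′ of crux `FluctuationComparisonRegPrL` (stmt-QuantumFields-19935), (R1) «print's χ back», part 12:
# THE PER-BLOCK-SIZE SOCKETS (RULING g21-№1 §2(c) «a per-L socket variant … a convenience r1 may land») and the consequence «AT A BLOCK SIZE BELOW THE FLOOR, 4′ IS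
# 2′ ∧ (i)* MODULO [7] THM 1 AND POSITIVITY» — no edge mathematics there

Cell `ym3-torus`, width-lever lane `ym-ust-19935-r1`; parts 1–11 landed/pending.  Count-neutral helper (`--supports stmt-QuantumFields-19935`).  Pure bookkeeping; no numerics;
nothing of [Balaban1985UV3]/[King1986] asserted; [Balaban1985Variational] Thm 1 enters as the schema `Thm1GlobalMinAt`.

* `fourPrimeAt_of_laneRecords_slackOnChi_edge_at (L) (μ)` — 4′'s text AT ONE odd `L < 7` from 2′, (i) at `(L, μ)` in the K1a-on-χ currency and (ii) at `(L, μ)`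
  (the per-L, fixed-margin body of part 8's §3).
* `fourPrimeAt_of_slackOnChiAll_edgeSome (L)` — 4′ AT `L` from 2′, (i)*(L) [∀ μ] and (ii)*(L) [∃ μ] (per-L form of part 8's §4 socket).
* `fourPrimeAt_of_slackOnChiAll_of_thm1GlobalMinAt (L)` — **4′ AT `L` from 2′ ∧ (i)*(L) ∧ `Thm1GlobalMinAt L a₀ a₁ B₃` with `2B₃ < L√L` ∧ frequent positivity on the window**
  (part 11 supplies (ii)*(L)).  READING: with [7]'s gain `B₃ ≈ 4–4.3` this is the `L = 5` member of 4′ (11.18 > 2B₃); `L = 3` keeps its genuine edge clause (FINDING #44).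

References: C. King, CMP 102 (1986) 649–677 [King1986] (Thm 3.4 (3.9) p.656); T. Bałaban, CMP 102 (1985) 277–309 [Balaban1985Variational] (Thm 1 (8) p.279).
-/

noncomputable section

namespace Summit.QuantumFields.YangMills.Theorems.PrintChi

open MeasureTheory Filter
open Literature.MathematicalPhysics.QuantumFieldTheory.Balaban1983to89
open Literature.MathematicalPhysics.QuantumFieldTheory.Balaban1983to89.T3ContinuumYM3Torus
open Literature.MathematicalPhysics.QuantumFieldTheory.Balaban1983to89.T3UnitLawDensityEML (ℰp measurableE_ℰp)
open Literature.MathematicalPhysics.QuantumFieldTheory.Balaban1983to89.T3UnitScaleTilt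
open Literature.MathematicalPhysics.QuantumFieldTheory.Balaban1983to89.T3TiltDescent
open Literature.MathematicalPhysics.QuantumFieldTheory.Balaban1983to89.T3PrintedRegularMinimiser
open Literature.MathematicalPhysics.QuantumFieldTheory.Balaban1983to89.T3PrintedMinimiserExistence
open Literature.MathematicalPhysics.QuantumFieldTheory.Balaban1983to89.T3LogComparisonSocket
open Literature.MathematicalPhysics.QuantumFieldTheory.Balaban1983to89.T3AlphaInputsAC
open Summit.QuantumFields.YangMills.Theorems.GlobalSlack

/-- **4′ AT ONE BLOCK SIZE AND ONE MARGIN from 2′, the K1a-on-χ row at `(L, μ)` and the edge clause at `(L, μ)`** — the per-`L`, fixed-`μ` body of part 8's composition (record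
with `(𝔠.b₀, 𝔠.p₀) = (b₀, p₀)`, (A) by `repAtHeights_dataOfV3`, thresholds `exists_gamma_thresholds`, χ-S-E″, `stubBodyOn_of_repOn_of_cauchyOn`, glue `SmallBlocksSplit.aeBound_of_inner_of_edge`).
[cite: King1986, Thm 3.4 (3.9) p.656] -/
theorem fourPrimeAt_of_laneRecords_slackOnChi_edge_at (L : ℕ) (hLo : Odd L) (hL : 1 < L) (hL7 : L < 7) (μ : ℝ)
    (h2 : Summit.QuantumFields.YangMills.Theorems.AlphaInputsT3ACv3Rec L)
    (hIμ :
      ∀ (𝔠 : Summit.QuantumFields.Balaban3D.Proofs.Primitives.AlphaConsts L (Summit.QuantumFields.Balaban3D.Carriers.suGroupModel 2).N)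
        (a₀ a₁ : ℝ), 0 < a₀ → 0 < a₁ → 𝔠.B₃ * a₁ ≤ a₀ →
        ∃ a : ℝ, 0 < a ∧ ∃ γB : ℝ, 0 < γB ∧ ∀ (F : T3Family) (γ : ℝ) (hF : F.L = L) (hγ : 0 < γ), γ ≤ γB →
          ∀ (hγ1 : γ ≤ (min (hF ▸ 𝔠).gamma0 1) ^ 2),
            Summit.QuantumFields.YangMills.Theorems.AlphaInputsT3AC.OfV3At F (hF ▸ 𝔠) a₀ a₁ →
            ∃ (p : ∀ K, Summit.QuantumFields.YangMills.Theorems.AlphaInputsT3AC.PkgAtV3 F (hF ▸ 𝔠) γ hγ hγ1 K),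
              (∀ K, (p K).a₀ = a₀ ∧ (p K).a₁ = a₁) ∧
              ∃ (π : Summit.QuantumFields.YangMills.Theorems.AlphaInputsT3AC.PolymerT3 F) (σ : ℕ) (C : ℝ), 7 ≤ σ ∧ 0 ≤ C ∧
                ∀ ε₀ : ℝ, 0 < ε₀ → ε₀ ≤ a₀ →
                  GlobalSupRateTSlackOn (fun K n h V => ChiGood F γ (hF ▸ 𝔠).b₀ (hF ▸ 𝔠).p₀ ε₀ μ (n := n) (K := K) h V)
                    (Summit.QuantumFields.YangMills.Theorems.AlphaInputsT3AC.dataOfV3 p π) (hF ▸ 𝔠).b₀ (hF ▸ 𝔠).p₀ a σ C)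
    (hIIμ : ∃ (b₁ p₁ : ℝ), ∀ (b₀ p₀ : ℝ), b₁ ≤ b₀ → p₁ ≤ p₀ → 0 < b₀ → 2 < p₀ →
      ∃ ε₁ : ℝ, 0 < ε₁ ∧ ∀ (ε₀ : ℝ), 0 < ε₀ → ε₀ ≤ ε₁ → ∃ m₀ : ℕ, ∀ (m : ℕ), m₀ ≤ m →
        ∃ γ₁ : ℝ, 0 < γ₁ ∧ ∀ (F : T3Family) (γ : ℝ), F.L = L → 0 < γ → γ ≤ γ₁ →
          ∃ r' : ℕ → ℝ, Summable r' ∧ (∀ K, 0 ≤ r' K) ∧ ∀ K, ∃ c : ℝ,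
            (∀ᵐ V ∂fieldMeasure (F.P (K / m)) 0 (Matrix.specialUnitaryGroup (Fin 2) ℂ),
              PlaqSmall (θBal F.L γ b₀ p₀ (K / m)) V →
                ¬ (ChiGood F γ b₀ p₀ ε₀ μ (Nat.div_le_self K m) V ∧
                    ChiGood F γ b₀ p₀ ε₀ μ ((Nat.div_le_self K m).trans (Nat.le_succ K)) V) →
                0 < heightDensity F γ (Nat.div_le_self K m) (histGood F ℰp (θBal F.L γ b₀ p₀) K (K / m)) V →
                0 < heightDensity F γ ((Nat.div_le_self K m).trans (Nat.le_succ K))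
                      (histGood F ℰp (θBal F.L γ b₀ p₀) (K + 1) (K / m)) V →
                  |(Real.log (heightDensity F γ ((Nat.div_le_self K m).trans (Nat.le_succ K))
                        (histGood F ℰp (θBal F.L γ b₀ p₀) (K + 1) (K / m)) V) + bgRegPr' F γ m ε₀ K V) -
                    (Real.log (heightDensity F γ (Nat.div_le_self K m) (histGood F ℰp (θBal F.L γ b₀ p₀) K (K / m)) V) + bgRegPr F γ m ε₀ K V) -
                      c| ≤ r' K) ∧
            (∃ᵐ V ∂fieldMeasure (F.P (K / m)) 0 (Matrix.specialUnitaryGroup (Fin 2) ℂ),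
              (PlaqSmall (θBal F.L γ b₀ p₀ (K / m)) V ∧
                ChiGood F γ b₀ p₀ ε₀ μ (Nat.div_le_self K m) V ∧
                ChiGood F γ b₀ p₀ ε₀ μ ((Nat.div_le_self K m).trans (Nat.le_succ K)) V) ∧
                0 < heightDensity F γ (Nat.div_le_self K m) (histGood F ℰp (θBal F.L γ b₀ p₀) K (K / m)) V ∧
                0 < heightDensity F γ ((Nat.div_le_self K m).trans (Nat.le_succ K))
                      (histGood F ℰp (θBal F.L γ b₀ p₀) (K + 1) (K / m)) V ∧
                  |(Real.log (heightDensity F γ ((Nat.div_le_self K m).trans (Nat.le_succ K))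
                        (histGood F ℰp (θBal F.L γ b₀ p₀) (K + 1) (K / m)) V) + bgRegPr' F γ m ε₀ K V) -
                    (Real.log (heightDensity F γ (Nat.div_le_self K m) (histGood F ℰp (θBal F.L γ b₀ p₀) K (K / m)) V) + bgRegPr F γ m ε₀ K V) -
                      c| ≤ r' K)) :
    ∃ (b₁ p₁ : ℝ), ∀ (b₀ p₀ : ℝ), b₁ ≤ b₀ → p₁ ≤ p₀ → 0 < b₀ → 2 < p₀ →
      ∃ ε₁ : ℝ, 0 < ε₁ ∧ ∀ (ε₀ : ℝ), 0 < ε₀ → ε₀ ≤ ε₁ → ∃ m₀ : ℕ, ∀ (m : ℕ), m₀ ≤ m →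
        ∃ γ₁ : ℝ, 0 < γ₁ ∧ ∀ (F : T3Family) (γ : ℝ), F.L = L → 0 < γ → γ ≤ γ₁ →
          ∃ (r κ : ℕ → ℝ), Summable r ∧ (∀ K, 0 ≤ r K) ∧
            ∀ K, ∀ᵐ V ∂fieldMeasure (F.P (K / m)) 0 (Matrix.specialUnitaryGroup (Fin 2) ℂ),
              PlaqSmall (θBal F.L γ b₀ p₀ (K / m)) V →
                0 < heightDensity F γ (Nat.div_le_self K m) (histGood F ℰp (θBal F.L γ b₀ p₀) K (K / m)) V →
                0 < heightDensity F γ ((Nat.div_le_self K m).trans (Nat.le_succ K))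
                      (histGood F ℰp (θBal F.L γ b₀ p₀) (K + 1) (K / m)) V →
                  |(Real.log (heightDensity F γ ((Nat.div_le_self K m).trans (Nat.le_succ K))
                        (histGood F ℰp (θBal F.L γ b₀ p₀) (K + 1) (K / m)) V) + bgRegPr' F γ m ε₀ K V) -
                    (Real.log (heightDensity F γ (Nat.div_le_self K m) (histGood F ℰp (θBal F.L γ b₀ p₀) K (K / m)) V) + bgRegPr F γ m ε₀ K V) -
                      κ K| ≤ r K := by
  have _ := hL7
  obtain ⟨b₁', p₁', H2⟩ := hIIμ
  obtain ⟨b₁, p₁, hrec⟩ := h2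
  refine ⟨max b₁ b₁', max p₁ p₁', fun b₀ p₀ hb1 hp1 hb hp => ?_⟩
  obtain ⟨𝔠, a₀, a₁, hcb, hcp, ha0, ha1, hw, h𝔠⟩ := hrec b₀ p₀ ((le_max_left _ _).trans hb1) ((le_max_left _ _).trans hp1)
  obtain ⟨ε₁', hε₁', H2'⟩ := H2 b₀ p₀ ((le_max_right _ _).trans hb1) ((le_max_right _ _).trans hp1) hb hp
  subst hcb
  subst hcp
  obtain ⟨a, ha, γB, hγB, hBC⟩ := hIμ 𝔠 a₀ a₁ ha0 ha1 hw
  obtain ⟨εs, hεs, hS⟩ := levelCauchyOnOfGlobalSupRateTSlackOn_dec L hLo hL a ha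
  refine ⟨min (min a₀ εs) ε₁', lt_min (lt_min ha0 hεs) hε₁', fun ε₀ h0 h1 => ?_⟩
  have h1a : ε₀ ≤ a₀ := h1.trans ((min_le_left _ _).trans (min_le_left _ _))
  have h1s : ε₀ ≤ εs := h1.trans ((min_le_left _ _).trans (min_le_right _ _))
  have h1e : ε₀ ≤ ε₁' := h1.trans (min_le_right _ _)
  obtain ⟨m₀, hm₀⟩ := hS ε₀ h0 h1s
  obtain ⟨m₀', Hm₂⟩ := H2' ε₀ h0 h1e
  refine ⟨max (max m₀ 1) m₀', fun m hm => ?_⟩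
  have hmpos : 0 < m := Nat.lt_of_lt_of_le Nat.one_pos (((le_max_right _ _).trans (le_max_left _ _)).trans hm)
  obtain ⟨γT, hγT, -, hT⟩ := Summit.QuantumFields.YangMills.Theorems.LogComparisonAlphaAdapter.exists_gamma_thresholds
    (B₃ := 𝔠.B₃) 𝔠.b₀_pos 𝔠.p₀_pos ha1 𝔠.B₃_pos.le h0
  have hg0 : 0 < (min 𝔠.gamma0 1) ^ 2 := pow_pos (lt_min 𝔠.gamma0_pos one_pos) 2
  obtain ⟨γs, hγs, hS'⟩ := hm₀ m (((le_max_left _ _).trans (le_max_left _ _)).trans hm) 𝔠.b₀ 𝔠.p₀ hb hp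
  obtain ⟨γe, hγe, HE⟩ := Hm₂ m ((le_max_right _ _).trans hm)
  refine ⟨min (min (min γB (min γT ((min 𝔠.gamma0 1) ^ 2))) γs) γe,
    lt_min (lt_min (lt_min hγB (lt_min hγT hg0)) hγs) hγe, fun F γ hF hγ hγ₁ => ?_⟩
  subst hF
  have hγB' : γ ≤ γB := hγ₁.trans ((min_le_left _ _).trans ((min_le_left _ _).trans (min_le_left _ _)))
  have hγT' : γ ≤ γT := hγ₁.trans ((min_le_left _ _).trans ((min_le_left _ _).trans ((min_le_right _ _).trans (min_le_left _ _))))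
  have hγ1 : γ ≤ (min 𝔠.gamma0 1) ^ 2 :=
    hγ₁.trans ((min_le_left _ _).trans ((min_le_left _ _).trans ((min_le_right _ _).trans (min_le_right _ _))))
  have hγs' : γ ≤ γs := hγ₁.trans ((min_le_left _ _).trans (min_le_right _ _))
  have hγe' : γ ≤ γe := hγ₁.trans (min_le_right _ _)
  obtain ⟨p, hp', π, σ, C, hσ, hC0, hG⟩ := hBC F γ rfl hγ hγB' hγ1 (h𝔠 F rfl)
  obtain ⟨hT1, hT2, hT3⟩ := hT F.L F.hL.2.le γ hγ hγT'
  have hRep := Summit.QuantumFields.YangMills.Theorems.AlphaInputsT3AC.repAtHeights_dataOfV3 p π hp' ε₀ h0 h1a hT1 hT2 hT3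
  have hrepOn : TwoSidedRepOn F γ 𝔠.b₀ 𝔠.p₀ (fun K n h V => ChiGood F γ 𝔠.b₀ 𝔠.p₀ ε₀ μ (n := n) (K := K) h V) ε₀
      (Summit.QuantumFields.YangMills.Theorems.AlphaInputsT3AC.dataOfV3 p π).PintH
      (Summit.QuantumFields.YangMills.Theorems.AlphaInputsT3AC.dataOfV3 p π).EcstH
      (Summit.QuantumFields.YangMills.Theorems.AlphaInputsT3AC.dataOfV3 p π).RmH :=
    twoSidedRepOn_of_repAt _ hRep
  have hCau := hS' F γ rfl hγ hγs' (fun K n h V => ChiGood F γ 𝔠.b₀ 𝔠.p₀ ε₀ μ (n := n) (K := K) h V)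
    (Summit.QuantumFields.YangMills.Theorems.AlphaInputsT3AC.dataOfV3 p π) σ C hσ hC0 (hG ε₀ h0 h1a)
  obtain ⟨r, κ, hr, hr0, hC⟩ := stubBodyOn_of_repOn_of_cauchyOn F γ 𝔠.b₀ 𝔠.p₀ ε₀ hmpos _ _ _ _ hrepOn hCau
  obtain ⟨r', hr', hr'0, hB⟩ := HE F γ rfl hγ hγe'
  exact SmallBlocksSplit.aeBound_of_inner_of_edge
    (fun K => fieldMeasure (F.P (K / m)) 0 (Matrix.specialUnitaryGroup (Fin 2) ℂ))
    (fun K V => PlaqSmall (θBal F.L γ 𝔠.b₀ 𝔠.p₀ (K / m)) V)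
    (fun K V => PlaqSmall (θBal F.L γ 𝔠.b₀ 𝔠.p₀ (K / m)) V ∧
      ChiGood F γ 𝔠.b₀ 𝔠.p₀ ε₀ μ (Nat.div_le_self K m) V ∧
      ChiGood F γ 𝔠.b₀ 𝔠.p₀ ε₀ μ ((Nat.div_le_self K m).trans (Nat.le_succ K)) V)
    (fun K V => 0 < heightDensity F γ (Nat.div_le_self K m) (histGood F ℰp (θBal F.L γ 𝔠.b₀ 𝔠.p₀) K (K / m)) V)
    (fun K V => 0 < heightDensity F γ ((Nat.div_le_self K m).trans (Nat.le_succ K))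
      (histGood F ℰp (θBal F.L γ 𝔠.b₀ 𝔠.p₀) (K + 1) (K / m)) V)
    (fun K V => (Real.log (heightDensity F γ ((Nat.div_le_self K m).trans (Nat.le_succ K))
        (histGood F ℰp (θBal F.L γ 𝔠.b₀ 𝔠.p₀) (K + 1) (K / m)) V) + bgRegPr' F γ m ε₀ K V) -
      (Real.log (heightDensity F γ (Nat.div_le_self K m) (histGood F ℰp (θBal F.L γ 𝔠.b₀ 𝔠.p₀) K (K / m)) V) + bgRegPr F γ m ε₀ K V))
    ⟨r, κ, hr, hr0, fun K => by
      filter_upwards [hC K] with V hV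
      rintro ⟨hs, hχ, hχ'⟩ h0' h0''
      exact hV hs hχ hχ' h0' h0''⟩
    ⟨r', hr', hr'0, fun K => by
      obtain ⟨c, hc, hfreq⟩ := hB K
      refine ⟨c, ?_, hfreq⟩
      filter_upwards [hc] with V hV
      intro hs hnotI h0' h0''
      exact hV hs (fun hχχ => hnotI ⟨hs, hχχ.1, hχχ.2⟩) h0' h0''⟩

/-- **4′ AT ONE BLOCK SIZE from 2′(L), (i)*(L) [EVERY margin] and (ii)*(L) [SOME margin]** — the per-`L` form of part 8's owner socket. [cite: King1986, Thm 3.4 (3.9) p.656] -/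
theorem fourPrimeAt_of_slackOnChiAll_edgeSome (L : ℕ) (hLo : Odd L) (hL : 1 < L) (hL7 : L < 7)
    (h2 : Summit.QuantumFields.YangMills.Theorems.AlphaInputsT3ACv3Rec L)
    (hI : ∀ (μ : ℝ), 0 < μ → μ < 1 →
      ∀ (𝔠 : Summit.QuantumFields.Balaban3D.Proofs.Primitives.AlphaConsts L (Summit.QuantumFields.Balaban3D.Carriers.suGroupModel 2).N)
        (a₀ a₁ : ℝ), 0 < a₀ → 0 < a₁ → 𝔠.B₃ * a₁ ≤ a₀ →
        ∃ a : ℝ, 0 < a ∧ ∃ γB : ℝ, 0 < γB ∧ ∀ (F : T3Family) (γ : ℝ) (hF : F.L = L) (hγ : 0 < γ), γ ≤ γB →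
          ∀ (hγ1 : γ ≤ (min (hF ▸ 𝔠).gamma0 1) ^ 2),
            Summit.QuantumFields.YangMills.Theorems.AlphaInputsT3AC.OfV3At F (hF ▸ 𝔠) a₀ a₁ →
            ∃ (p : ∀ K, Summit.QuantumFields.YangMills.Theorems.AlphaInputsT3AC.PkgAtV3 F (hF ▸ 𝔠) γ hγ hγ1 K),
              (∀ K, (p K).a₀ = a₀ ∧ (p K).a₁ = a₁) ∧
              ∃ (π : Summit.QuantumFields.YangMills.Theorems.AlphaInputsT3AC.PolymerT3 F) (σ : ℕ) (C : ℝ), 7 ≤ σ ∧ 0 ≤ C ∧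
                ∀ ε₀ : ℝ, 0 < ε₀ → ε₀ ≤ a₀ →
                  GlobalSupRateTSlackOn (fun K n h V => ChiGood F γ (hF ▸ 𝔠).b₀ (hF ▸ 𝔠).p₀ ε₀ μ (n := n) (K := K) h V)
                    (Summit.QuantumFields.YangMills.Theorems.AlphaInputsT3AC.dataOfV3 p π) (hF ▸ 𝔠).b₀ (hF ▸ 𝔠).p₀ a σ C)
    (hII : ∃ μ : ℝ, 0 < μ ∧ μ < 1 ∧ ∃ (b₁ p₁ : ℝ), ∀ (b₀ p₀ : ℝ), b₁ ≤ b₀ → p₁ ≤ p₀ → 0 < b₀ → 2 < p₀ →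
      ∃ ε₁ : ℝ, 0 < ε₁ ∧ ∀ (ε₀ : ℝ), 0 < ε₀ → ε₀ ≤ ε₁ → ∃ m₀ : ℕ, ∀ (m : ℕ), m₀ ≤ m →
        ∃ γ₁ : ℝ, 0 < γ₁ ∧ ∀ (F : T3Family) (γ : ℝ), F.L = L → 0 < γ → γ ≤ γ₁ →
          ∃ r' : ℕ → ℝ, Summable r' ∧ (∀ K, 0 ≤ r' K) ∧ ∀ K, ∃ c : ℝ,
            (∀ᵐ V ∂fieldMeasure (F.P (K / m)) 0 (Matrix.specialUnitaryGroup (Fin 2) ℂ),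
              PlaqSmall (θBal F.L γ b₀ p₀ (K / m)) V →
                ¬ (ChiGood F γ b₀ p₀ ε₀ μ (Nat.div_le_self K m) V ∧
                    ChiGood F γ b₀ p₀ ε₀ μ ((Nat.div_le_self K m).trans (Nat.le_succ K)) V) →
                0 < heightDensity F γ (Nat.div_le_self K m) (histGood F ℰp (θBal F.L γ b₀ p₀) K (K / m)) V →
                0 < heightDensity F γ ((Nat.div_le_self K m).trans (Nat.le_succ K))
                      (histGood F ℰp (θBal F.L γ b₀ p₀) (K + 1) (K / m)) V →
                  |(Real.log (heightDensity F γ ((Nat.div_le_self K m).trans (Nat.le_succ K))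
                        (histGood F ℰp (θBal F.L γ b₀ p₀) (K + 1) (K / m)) V) + bgRegPr' F γ m ε₀ K V) -
                    (Real.log (heightDensity F γ (Nat.div_le_self K m) (histGood F ℰp (θBal F.L γ b₀ p₀) K (K / m)) V) + bgRegPr F γ m ε₀ K V) -
                      c| ≤ r' K) ∧
            (∃ᵐ V ∂fieldMeasure (F.P (K / m)) 0 (Matrix.specialUnitaryGroup (Fin 2) ℂ),
              (PlaqSmall (θBal F.L γ b₀ p₀ (K / m)) V ∧
                ChiGood F γ b₀ p₀ ε₀ μ (Nat.div_le_self K m) V ∧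
                ChiGood F γ b₀ p₀ ε₀ μ ((Nat.div_le_self K m).trans (Nat.le_succ K)) V) ∧
                0 < heightDensity F γ (Nat.div_le_self K m) (histGood F ℰp (θBal F.L γ b₀ p₀) K (K / m)) V ∧
                0 < heightDensity F γ ((Nat.div_le_self K m).trans (Nat.le_succ K))
                      (histGood F ℰp (θBal F.L γ b₀ p₀) (K + 1) (K / m)) V ∧
                  |(Real.log (heightDensity F γ ((Nat.div_le_self K m).trans (Nat.le_succ K))
                        (histGood F ℰp (θBal F.L γ b₀ p₀) (K + 1) (K / m)) V) + bgRegPr' F γ m ε₀ K V) -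
                    (Real.log (heightDensity F γ (Nat.div_le_self K m) (histGood F ℰp (θBal F.L γ b₀ p₀) K (K / m)) V) + bgRegPr F γ m ε₀ K V) -
                      c| ≤ r' K)) :
    ∃ (b₁ p₁ : ℝ), ∀ (b₀ p₀ : ℝ), b₁ ≤ b₀ → p₁ ≤ p₀ → 0 < b₀ → 2 < p₀ →
      ∃ ε₁ : ℝ, 0 < ε₁ ∧ ∀ (ε₀ : ℝ), 0 < ε₀ → ε₀ ≤ ε₁ → ∃ m₀ : ℕ, ∀ (m : ℕ), m₀ ≤ m →
        ∃ γ₁ : ℝ, 0 < γ₁ ∧ ∀ (F : T3Family) (γ : ℝ), F.L = L → 0 < γ → γ ≤ γ₁ →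
          ∃ (r κ : ℕ → ℝ), Summable r ∧ (∀ K, 0 ≤ r K) ∧
            ∀ K, ∀ᵐ V ∂fieldMeasure (F.P (K / m)) 0 (Matrix.specialUnitaryGroup (Fin 2) ℂ),
              PlaqSmall (θBal F.L γ b₀ p₀ (K / m)) V →
                0 < heightDensity F γ (Nat.div_le_self K m) (histGood F ℰp (θBal F.L γ b₀ p₀) K (K / m)) V →
                0 < heightDensity F γ ((Nat.div_le_self K m).trans (Nat.le_succ K))
                      (histGood F ℰp (θBal F.L γ b₀ p₀) (K + 1) (K / m)) V →
                  |(Real.log (heightDensity F γ ((Nat.div_le_self K m).trans (Nat.le_succ K))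
                        (histGood F ℰp (θBal F.L γ b₀ p₀) (K + 1) (K / m)) V) + bgRegPr' F γ m ε₀ K V) -
                    (Real.log (heightDensity F γ (Nat.div_le_self K m) (histGood F ℰp (θBal F.L γ b₀ p₀) K (K / m)) V) + bgRegPr F γ m ε₀ K V) -
                      κ K| ≤ r K := by
  obtain ⟨μ, hμ0, hμ1, hE⟩ := hII
  exact fourPrimeAt_of_laneRecords_slackOnChi_edge_at L hLo hL hL7 μ h2 (hI μ hμ0 hμ1) hE

/-- **AT A BLOCK SIZE BELOW THE FLOOR, 4′ IS 2′ ∧ (i)* MODULO [7] THM 1 AND POSITIVITY**: for odd `1 < L < 7` with `Thm1GlobalMinAt L a₀ a₁ B₃`, `2B₃ < L√L`, and frequent positivity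
of both restricted densities on every comparison window below a coupling threshold, the lane records 2′(L) and the K1a-on-χ row (i)*(L) give 4′'s text at `L` — the edge stub
(ii)*(L) being part 11's theorem.  READING: the `L = 5` member of 4′ for [7]'s gain `B₃ < 5√5/2 ≈ 5.59`. [cite: Balaban1985Variational, Thm 1 (8) p.279] -/
theorem fourPrimeAt_of_slackOnChiAll_of_thm1GlobalMinAt (L : ℕ) (hLo : Odd L) (hL : 1 < L) (hL7 : L < 7)
    (h2 : Summit.QuantumFields.YangMills.Theorems.AlphaInputsT3ACv3Rec L)
    (hI : ∀ (μ : ℝ), 0 < μ → μ < 1 →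
      ∀ (𝔠 : Summit.QuantumFields.Balaban3D.Proofs.Primitives.AlphaConsts L (Summit.QuantumFields.Balaban3D.Carriers.suGroupModel 2).N)
        (a₀ a₁ : ℝ), 0 < a₀ → 0 < a₁ → 𝔠.B₃ * a₁ ≤ a₀ →
        ∃ a : ℝ, 0 < a ∧ ∃ γB : ℝ, 0 < γB ∧ ∀ (F : T3Family) (γ : ℝ) (hF : F.L = L) (hγ : 0 < γ), γ ≤ γB →
          ∀ (hγ1 : γ ≤ (min (hF ▸ 𝔠).gamma0 1) ^ 2),
            Summit.QuantumFields.YangMills.Theorems.AlphaInputsT3AC.OfV3At F (hF ▸ 𝔠) a₀ a₁ →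
            ∃ (p : ∀ K, Summit.QuantumFields.YangMills.Theorems.AlphaInputsT3AC.PkgAtV3 F (hF ▸ 𝔠) γ hγ hγ1 K),
              (∀ K, (p K).a₀ = a₀ ∧ (p K).a₁ = a₁) ∧
              ∃ (π : Summit.QuantumFields.YangMills.Theorems.AlphaInputsT3AC.PolymerT3 F) (σ : ℕ) (C : ℝ), 7 ≤ σ ∧ 0 ≤ C ∧
                ∀ ε₀ : ℝ, 0 < ε₀ → ε₀ ≤ a₀ →
                  GlobalSupRateTSlackOn (fun K n h V => ChiGood F γ (hF ▸ 𝔠).b₀ (hF ▸ 𝔠).p₀ ε₀ μ (n := n) (K := K) h V)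
                    (Summit.QuantumFields.YangMills.Theorems.AlphaInputsT3AC.dataOfV3 p π) (hF ▸ 𝔠).b₀ (hF ▸ 𝔠).p₀ a σ C)
    {a₀ a₁ B₃ : ℝ} (ha₀ : 0 < a₀) (ha₁ : 0 < a₁) (hB₃ : 0 < B₃) (hfloor : 2 * B₃ < (L : ℝ) * Real.sqrt L)
    (hT : Thm1GlobalMinAt L a₀ a₁ B₃)
    (hposL : ∀ (m : ℕ), 0 < m → ∀ (b₀ p₀ : ℝ), 0 < b₀ → 2 < p₀ → ∃ γp : ℝ, 0 < γp ∧ ∀ (F : T3Family) (γ : ℝ), F.L = L → 0 < γ → γ ≤ γp →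
      ∀ K, ∃ᵐ V ∂fieldMeasure (F.P (K / m)) 0 (Matrix.specialUnitaryGroup (Fin 2) ℂ),
      PlaqSmall (θBal F.L γ b₀ p₀ (K / m)) V ∧
        0 < heightDensity F γ (Nat.div_le_self K m) (histGood F ℰp (θBal F.L γ b₀ p₀) K (K / m)) V ∧
        0 < heightDensity F γ ((Nat.div_le_self K m).trans (Nat.le_succ K)) (histGood F ℰp (θBal F.L γ b₀ p₀) (K + 1) (K / m)) V) :
    ∃ (b₁ p₁ : ℝ), ∀ (b₀ p₀ : ℝ), b₁ ≤ b₀ → p₁ ≤ p₀ → 0 < b₀ → 2 < p₀ →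
      ∃ ε₁ : ℝ, 0 < ε₁ ∧ ∀ (ε₀ : ℝ), 0 < ε₀ → ε₀ ≤ ε₁ → ∃ m₀ : ℕ, ∀ (m : ℕ), m₀ ≤ m →
        ∃ γ₁ : ℝ, 0 < γ₁ ∧ ∀ (F : T3Family) (γ : ℝ), F.L = L → 0 < γ → γ ≤ γ₁ →
          ∃ (r κ : ℕ → ℝ), Summable r ∧ (∀ K, 0 ≤ r K) ∧
            ∀ K, ∀ᵐ V ∂fieldMeasure (F.P (K / m)) 0 (Matrix.specialUnitaryGroup (Fin 2) ℂ),
              PlaqSmall (θBal F.L γ b₀ p₀ (K / m)) V →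
                0 < heightDensity F γ (Nat.div_le_self K m) (histGood F ℰp (θBal F.L γ b₀ p₀) K (K / m)) V →
                0 < heightDensity F γ ((Nat.div_le_self K m).trans (Nat.le_succ K))
                      (histGood F ℰp (θBal F.L γ b₀ p₀) (K + 1) (K / m)) V →
                  |(Real.log (heightDensity F γ ((Nat.div_le_self K m).trans (Nat.le_succ K))
                        (histGood F ℰp (θBal F.L γ b₀ p₀) (K + 1) (K / m)) V) + bgRegPr' F γ m ε₀ K V) -
                    (Real.log (heightDensity F γ (Nat.div_le_self K m) (histGood F ℰp (θBal F.L γ b₀ p₀) K (K / m)) V) + bgRegPr F γ m ε₀ K V) -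
                      κ K| ≤ r K := by
  exact fourPrimeAt_of_slackOnChiAll_edgeSome L hLo hL hL7 h2 hI
    (edgeOffChiAt_of_thm1GlobalMinAt L hLo hL ha₀ ha₁ hB₃ hfloor hT hposL)

end Summit.QuantumFields.YangMills.Theorems.PrintChi

end
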